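import Mathlib.Data.Fin.Embedding
import Literature.Computability.Complexity.BranchingFn
import Literature.ModelTheory.FiniteModelTheory.CPT
import HarnessLib

/-!
# The CPT interface: inhabited for every universal machine, and capturing is NOT automatic

Companion to `CPT.lean` (interface `CPTInterface U` for Choiceless Polynomial Time with
counting, Blass–Gurevich–Shelah 1999) and `CapturingPTIME.lean` (Gurevich logics). Two facts
the interface file left open are PROVED here, for EVERY clocked universal machine `U`:

* **Non-vacuity with sentences.** `GurevichLogic.propConst U` / `CPTInterface.propConst U` — the
  LOGIC OF BOOLEAN CONSTANTS: every string is a sentence and `G ⊨ φ ↔ φ.headI = true` (a sentence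
  denotes `true` or `false` according to its first bit). Its evaluator compiles `φ` to a
  `U`-program printing the constant bit `φ.headI`; such programs exist for every `U`
  (`exists_program_run_eq_const`: the constant string function is in `FP` (`const_mem_FP`), so
  `U.sim` gives a code with polynomial overhead, and `run_mono` pads the clock to the normal form
  `|w| ^ k + k`). All axioms of `CPTInterface` (complement / ∧ / ∨ / `false` / `true`) hold, so
  `CPTInterface U` is inhabited (`CPTInterface.nonempty`) — previously only the EMPTY Gurevich
  logic was known to inhabit `GurevichLogic U` (`GurevichLogic.empty`).
* **The axioms do not force capturing.** The class `noVertexClass` of graphs with no vertices is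
  isomorphism-closed and polynomial-time (its language of codes is the singleton
  `{⌜⟨0, ⊥⟩⌝}`, in `P` by `setOf_apply_eq_apply_mem_P`), but it is neither `∅` nor everything,
  hence not `propConst`-definable; so `propConst U` does NOT capture PTIME
  (`not_capturesPTIME_propConst`), `∃ L : CPTInterface U, ¬ L.CapturesPTIME`
  (`exists_not_capturesPTIME`), and the route shape `CPTCapturesPTIME IsCPTCard` FAILS for the
  trivial pinning predicate `fun _ => True` (`not_cptCapturesPTIME_top`): a pinning predicate
  supplied by the construction item must be a genuine restriction.

Consequently `CPTInterface.CapturesPTIME` is a PREDICATE on interfaces (true for some `L` iff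
Gurevich's question has a positive answer, false for `propConst U`), not a closed statement that
could be "discharged"; `CPT.lean` records it with an explicit binder accordingly.

## References

* A. Blass, Y. Gurevich, S. Shelah, *Choiceless polynomial time*, Ann. Pure Appl. Logic 100
  (1999) 141–187, arXiv:math/9705225, §1 (the notion of a logic capturing PTIME; the question).
* Y. Gurevich, *Logic and the challenge of computer science* (1988), §1.
* S. Arora, B. Barak, *Computational Complexity: A Modern Approach*, CUP 2009, Thm 1.9
  (efficient universal simulation), §1.3.
-/

noncomputable section

open Computability Literature.Computability.Complexity Literature.Computability.Complexity.Classes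
  Literature.Computability.MetaComplexity

namespace Literature.ModelTheory.FiniteModelTheory

/-! ### Constant-output programs for a clocked universal machine -/

/-- **Constant-output programs.** For every clocked universal machine `U` and every string `y`
there is a program `e` and an exponent `k` such that `U`, run on `⟨e, w⟩` with clock
`|w| ^ k + k`, outputs `y`, for EVERY input `w`. Proof: the constant function `w ↦ y` is in
`FP` (`const_mem_FP`), i.e. computed by a TM2 machine within a polynomial clock; `U.sim`
simulates that machine with polynomial overhead; `run_mono` pads the composite polynomial clock
(bounded by `c * n ^ k + c`, `exists_eval_le_mul_pow_add`) to the normal form `n ^ K + K`.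
[Arora–Barak 2009, Thm 1.9 and §1.3] [folklore] -/
theorem exists_program_run_eq_const (U : UniversalMachine) (y : List Bool) :
    ∃ (e : List Bool) (k : ℕ), ∀ w : List Bool,
      U.run (boolPair e w) (w.length ^ k + k) = some y := by
  obtain ⟨p, M, hM⟩ := const_mem_FP y
  have hM' : ∀ w : List Bool, M.OutputsWithin w y (p.eval w.length) := fun w => hM w
  obtain ⟨e, q, hsim⟩ := U.sim M
  obtain ⟨c, k, hck⟩ := exists_eval_le_mul_pow_add (q.comp p)
  refine ⟨e, k + 1 + (c ^ (k + 1) + c), fun w =>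
    U.run_mono ?_ (hsim w y (p.eval w.length) (hM' w))⟩
  rw [← Polynomial.eval_comp]
  refine (hck _).trans ?_
  generalize w.length = n
  -- `c * n ^ k + c ≤ n ^ (k + 1 + (c ^ (k + 1) + c)) + (k + 1 + (c ^ (k + 1) + c))`
  have hmain : c * n ^ k + c ≤ n ^ (k + 1) + (c ^ (k + 1) + c) := by
    rcases le_or_gt c n with hcn | hnc
    · have : c * n ^ k ≤ n ^ (k + 1) := by
        rw [pow_succ']
        exact Nat.mul_le_mul_right _ hcn
      omega
    · have : c * n ^ k ≤ c ^ (k + 1) := by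
        rw [pow_succ']
        exact Nat.mul_le_mul_left _ (Nat.pow_le_pow_left hnc.le k)
      omega
  refine hmain.trans (Nat.add_le_add ?_ (Nat.le_add_left _ _))
  rcases Nat.eq_zero_or_pos n with rfl | hn
  · simp
  · exact Nat.pow_le_pow_right hn (Nat.le_add_right _ _)

/-! ### The logic of Boolean constants -/

namespace GurevichLogic

variable (U : UniversalMachine)

/-- The program/exponent pair printing the bit `b` on every input (a choice of the data in
`exists_program_run_eq_const`). [folklore] -/
def constCode (b : Bool) : List Bool × ℕ :=
  (Classical.choose (exists_program_run_eq_const U [b]),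
    Classical.choose (Classical.choose_spec (exists_program_run_eq_const U [b])))

/-- Specification of `constCode`: run with clock `|w| ^ k + k` it prints `[b]`. [folklore] -/
theorem run_constCode (b : Bool) (w : List Bool) :
    U.run (boolPair (constCode U b).1 w) (w.length ^ (constCode U b).2 + (constCode U b).2) =
      some [b] :=
  Classical.choose_spec (Classical.choose_spec (exists_program_run_eq_const U [b])) w

/-- **The logic of Boolean constants** over the universal machine `U`: every string is a
sentence; `G ⊨ φ` iff the first bit of `φ` is `true` (so a sentence denotes the constant query
`true` or `false`); the evaluator compiles `φ` to the constant-output program for its first bit.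
It satisfies every axiom of a Gurevich logic (decidable syntax, isomorphism-invariant — indeed
structure-independent — semantics, effective polynomial-time evaluation). [Gurevich 1988, §1;
Blass–Gurevich–Shelah 1999, §1] [folklore] -/
def propConst : GurevichLogic U where
  Sen := Set.univ
  sen_computable := ⟨fun _ => inferInstanceAs (Decidable True), by
    simpa using (Computable.const true : Computable fun _ : List Bool => true)⟩
  Sat := fun _ φ => φ.headI = true
  sat_iso := fun _ _ _ _ _ _ => Iff.rfl
  compile := fun φ => constCode U φ.headI
  compile_computable := ((Primrec.dom_bool (constCode U)).comp Primrec.list_headI).to_comp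
  compile_spec := fun φ _ G => ⟨φ.headI, run_constCode U φ.headI (encodingGraph.encode G), Iff.rfl⟩

/-- Every string is a sentence of `propConst U`. [folklore] -/
@[simp] theorem propConst_sen : (propConst U).Sen = Set.univ := rfl

/-- Satisfaction in `propConst U` reads the first bit of the sentence. [folklore] -/
@[simp] theorem propConst_sat (G : FinGraph) (φ : List Bool) :
    (propConst U).Sat G φ ↔ φ.headI = true := Iff.rfl

/-- Membership in a model class, unfolded. [Gurevich 1988, §1] [folklore] -/
theorem mem_modelClass_iff {U : UniversalMachine} (L : GurevichLogic U) (φ : List Bool)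
    (G : FinGraph) : G ∈ L.ModelClass φ ↔ L.Sat G φ := Iff.rfl

end GurevichLogic

namespace CPTInterface

variable (U : UniversalMachine)

/-- **The logic of Boolean constants inhabits the CPT interface**: its definable queries
(`true`, `false`) are closed under complement, intersection and union — witnessed by the
one-bit sentences `[!b]`, `[b && c]`, `[b || c]`. [Blass–Gurevich–Shelah 1999, §6 (closure of
programs under Boolean combinations)] [folklore] -/
def propConst : CPTInterface U where
  toGurevichLogic := GurevichLogic.propConst U
  compl_mem := fun φ _ => ⟨[!φ.headI], Set.mem_univ _, fun G => by simp⟩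
  and_mem := fun φ _ ψ _ => ⟨[φ.headI && ψ.headI], Set.mem_univ _, fun G => by simp⟩
  or_mem := fun φ _ ψ _ => ⟨[φ.headI || ψ.headI], Set.mem_univ _, fun G => by simp⟩
  false_mem := ⟨[false], Set.mem_univ _, fun G => by simp⟩
  true_mem := ⟨[true], Set.mem_univ _, fun G => by simp⟩

/-- The underlying Gurevich logic of `CPTInterface.propConst U`. [folklore] -/
@[simp] theorem propConst_toGurevichLogic :
    (propConst U).toGurevichLogic = GurevichLogic.propConst U := rfl

/-- **`CPTInterface U` is inhabited for every `U`** (non-vacuity of the interface axioms — of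
the AXIOMS, not of being CPT+Card). [folklore] -/
theorem nonempty : Nonempty (CPTInterface U) := ⟨propConst U⟩

end CPTInterface

/-! ### A polynomial-time isomorphism-closed class that `propConst` does not define -/

/-- The class of finite graphs with NO vertices. [folklore] -/
def noVertexClass : Set FinGraph := {G | G.1 = 0}

/-- Membership in `noVertexClass`, unfolded. [folklore] -/
@[simp] theorem mem_noVertexClass_iff (G : FinGraph) : G ∈ noVertexClass ↔ G.1 = 0 := Iff.rfl

/-- `noVertexClass` is isomorphism-closed (isomorphic graphs have equinumerous vertex sets).
[folklore] -/
theorem isIsoClosed_noVertexClass : IsIsoClosed noVertexClass := by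
  intro n m G H h
  obtain ⟨e⟩ := h
  obtain rfl : n = m := Fin.equiv_iff_eq.mp ⟨e.toEquiv⟩
  exact Iff.rfl

/-- The language of codes of `noVertexClass` is the singleton `{⌜⟨0, ⊥⟩⌝}` (there is exactly one
graph on `Fin 0`). [folklore] -/
theorem graphClassLanguage_noVertexClass :
    graphClassLanguage noVertexClass = {w | w = encodingGraph.encode (⟨0, ⊥⟩ : FinGraph)} := by
  ext w
  constructor
  · rintro ⟨⟨n, G⟩, hn, rfl⟩
    obtain rfl : n = 0 := hn
    obtain rfl : G = ⊥ := by
      ext a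
      exact a.elim0
    rfl
  · rintro rfl
    exact ⟨⟨0, ⊥⟩, rfl, rfl⟩

/-- `noVertexClass` is polynomial-time decidable: a singleton language is the equaliser of the
identity and a constant map, both in `FP`. [Arora–Barak 2009, §1.3] [folklore] -/
theorem isPTIMEClass_noVertexClass : IsPTIMEClass noVertexClass := by
  unfold IsPTIMEClass
  rw [graphClassLanguage_noVertexClass]
  exact setOf_apply_eq_apply_mem_P (PolyTimeComputable.id _) (const_mem_FP _)

/-- `noVertexClass` is NOT definable in the logic of Boolean constants: its only definable
classes are everything (first bit `true`; but `⟨1, ⊥⟩ ∉ noVertexClass`) and `∅` (otherwise; but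
`⟨0, ⊥⟩ ∈ noVertexClass`). [folklore] -/
theorem not_definable_noVertexClass (U : UniversalMachine) :
    ¬ (CPTInterface.propConst U).Definable noVertexClass := by
  rintro ⟨φ, -, hφ⟩
  rw [CPTInterface.propConst_toGurevichLogic] at hφ
  cases hb : φ.headI
  · have h0 : (⟨0, ⊥⟩ : FinGraph) ∈ (GurevichLogic.propConst U).ModelClass φ := by
      rw [hφ]
      exact rfl
    rw [GurevichLogic.mem_modelClass_iff, GurevichLogic.propConst_sat, hb] at h0
    exact Bool.false_ne_true h0
  · have h1 : (⟨1, ⊥⟩ : FinGraph) ∈ (GurevichLogic.propConst U).ModelClass φ := by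
      rw [GurevichLogic.mem_modelClass_iff, GurevichLogic.propConst_sat, hb]
    rw [hφ] at h1
    exact Nat.one_ne_zero h1

/-! ### Consequences: capturing is not automatic -/

/-- **The logic of Boolean constants does not capture PTIME** (it misses `noVertexClass`).
[Gurevich 1988, §1; Blass–Gurevich–Shelah 1999, §1] [folklore] -/
theorem not_capturesPTIME_propConst (U : UniversalMachine) :
    ¬ (CPTInterface.propConst U).CapturesPTIME :=
  (CPTInterface.propConst U).not_capturesPTIME_of_not_definable isIsoClosed_noVertexClass
    isPTIMEClass_noVertexClass (not_definable_noVertexClass U)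

/-- The same at the level of Gurevich logics: `GurevichLogic.propConst U` does not capture
PTIME on graphs. [Gurevich 1988, §1] [folklore] -/
theorem not_capturesPTIMEOnGraphs_propConst (U : UniversalMachine) :
    ¬ CapturesPTIMEOnGraphs (GurevichLogic.propConst U) :=
  not_capturesPTIME_propConst U

/-- **The interface axioms do not force capturing**: for every `U` some inhabitant of
`CPTInterface U` fails to capture PTIME. Hence `CPTInterface.CapturesPTIME` is a genuine
PREDICATE on interfaces, not a statement with a truth value of its own. [folklore] -/
theorem exists_not_capturesPTIME (U : UniversalMachine) :
    ∃ L : CPTInterface U, ¬ L.CapturesPTIME :=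
  ⟨CPTInterface.propConst U, not_capturesPTIME_propConst U⟩

/-- Equivalently: it is FALSE that every inhabitant of `CPTInterface U` captures PTIME.
[folklore] -/
theorem not_forall_capturesPTIME (U : UniversalMachine) :
    ¬ ∀ L : CPTInterface U, L.CapturesPTIME := fun h =>
  not_capturesPTIME_propConst U (h _)

/-- The route shape `CPTCapturesPTIME IsCPTCard` FAILS for the trivial pinning predicate
`fun _ => True`: whatever predicate the construction item supplies must exclude `propConst U`.
[Blass–Gurevich–Shelah 1999, §1] [folklore] -/
theorem not_cptCapturesPTIME_top (U : UniversalMachine) :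
    ¬ CPTCapturesPTIME (U := U) (fun _ => True) := fun h =>
  not_capturesPTIME_propConst U (h _ trivial)

end Literature.ModelTheory.FiniteModelTheory
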